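import Summits.PneNP.PneNP.Theorems.ConvexRankGatesConvexGateBlindStubPerfectCompletenessFunctional

/-!
# `ExactLifting`: the mixed junta × anchor cell — the core certificate

Support file for crux `ConvexGateBlind` (stmt-PneNP-10680), line `xor-door-perfect-completeness`, open stub
`stub_exactLifting` (prover seat 0, session 18; sequel of `…ExactLiftingAnchoredOneSided.lean` and
`…ExactLiftingAnchoredMixed.lean`, memo ANALYSIS9 §3).

The one junta-type format of an anchored factorisation not excluded so far is the MIXED one: on the XOR core
`N(z,y) = V(z+y)` (`V` = number of violated equations of an XOR instance `A : V → Finset (Fin m)`, `c : V → 𝔽₂`)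
an identity `V(z+y) = ∑_l T_l(z,y) + α(z) β(y)` with `T_l ≥ 0`, each a `d`-junta of `z` OR of `y`, and `α, β > 0`.
This file proves the CERTIFICATE half of its exclusion (ANALYSIS9 §3, direct form): with Grigoriev's functional
`Ẽ = func A c 1` (perfect, Sherali–Adams-positive on `d`-juntas under `IsoHyp A 1 d`) and a "far" set `D`
(`D ∆ S` is never `∅` or an equation for `#S ≤ d` — e.g. the boundary of any vertex set `x` with `3 ≤ #x ≤ #V − 3`),
the kernel `Λ(z,y) = (𝟙_D(z) + 𝟙_D(y) − ½) · ẽ(z+y)` (`ẽ` the density of `Ẽ`, `𝟙_D` a parity class of `D`) satisfies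

* `row_sum_lowDeg` / `col_sum_lowDeg`: `∑_y Λ(z,y) g(y) = 𝟙_D(z) · Ẽ[g(z+·)]` for every `g` of Fourier degree `≤ d`
  (the far character `χ_D` is invisible to `Ẽ` on low-degree functions, `func_chi_mul_eq_zero`);
* hence `⟨Λ, V(z+y)⟩ = 0`, `⟨Λ, T⟩ ≥ 0` for every one-sided non-negative `d`-junta term (either side), and
  `⟨Λ, α ⊗ β⟩ = ∑_z α(z) 𝟙_D(z) β̌(z)` with `β̌(z) := Ẽ[β(z+·)]` when `β` has degree `≤ d`;
* `mixed_anchor_core_contra_of` (registered form `mixed_anchor_core_contra`): so if `β` has degree `≤ d`, `β̌ ≥ 0` on the class `𝟙_D = 1` and `β̌ > 0` somewhere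
  on it, the identity is impossible.

The remaining half (the anchor IS low-degree on one side — `anchor_annihilator_mul_eq_zero`, p106309 — and the sign
condition holds for one of the two parity classes of `D` — the positivity lemma) is the sequel file. Everything is
size-free and uses only the Fourier–Walsh toolkit of `…StubPerfectCompletenessFourier/Functional`.
-/

set_option linter.dupNamespace false -- `Summit.PneNP.PneNP.…`: summit = sub-problem (D-0017)

namespace Summit.PneNP.PneNP.Theorems.XorDoor.PC

open Finset

noncomputable section

variable {m : ℕ}

/-! ## §1 Fourier preliminaries: low degree, translation, the parity indicator -/

/-! Throughout, "`f` has Fourier degree `≤ d`" is spelled `∀ S, d < S.card → coeff f S = 0`. -/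

/-- A `d`-junta has degree `≤ d`. -/
theorem lowDeg_of_junta {d : ℕ} {f : (Fin m → ZMod 2) → ℝ} {U : Finset (Fin m)} (hU : U.card ≤ d)
    (hf : ∀ x y : Fin m → ZMod 2, (∀ i ∈ U, x i = y i) → f x = f y) :
    ∀ S : Finset (Fin m), d < S.card → coeff f S = 0 :=
  fun S hS => coeff_eq_zero_of_not_subset hf fun h => absurd (card_le_card h) (by omega)

/-- Low degree is preserved by sums. -/
theorem lowDeg_add {d : ℕ} {f g : (Fin m → ZMod 2) → ℝ}
    (hf : ∀ S : Finset (Fin m), d < S.card → coeff f S = 0)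
    (hg : ∀ S : Finset (Fin m), d < S.card → coeff g S = 0) :
    ∀ S : Finset (Fin m), d < S.card → coeff (f + g) S = 0 := fun S hS => by
  rw [← coeffLin_apply, map_add, coeffLin_apply, coeffLin_apply, hf S hS, hg S hS, add_zero]

/-- Low degree is preserved by scalar multiples. -/
theorem lowDeg_smul {d : ℕ} {f : (Fin m → ZMod 2) → ℝ} (a : ℝ)
    (hf : ∀ S : Finset (Fin m), d < S.card → coeff f S = 0) :
    ∀ S : Finset (Fin m), d < S.card → coeff (a • f) S = 0 := fun S hS => by
  rw [← coeffLin_apply, map_smul, coeffLin_apply, hf S hS, smul_zero]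

/-- Low degree is preserved by finite sums. -/
theorem lowDeg_sum {d : ℕ} {ι : Type*} (s : Finset ι) {f : ι → (Fin m → ZMod 2) → ℝ}
    (hf : ∀ i ∈ s, ∀ S : Finset (Fin m), d < S.card → coeff (f i) S = 0) :
    ∀ S : Finset (Fin m), d < S.card → coeff (∑ i ∈ s, f i) S = 0 := by
  classical
  induction s using Finset.induction_on with
  | empty => intro S _; simp [coeff]
  | insert a s ha ih =>
    rw [Finset.sum_insert ha]
    exact lowDeg_add (hf a (mem_insert_self a s)) (ih fun i hi => hf i (mem_insert_of_mem hi))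

/-- A character on at most `d` coordinates has degree `≤ d`. -/
theorem lowDeg_chi {d : ℕ} {T : Finset (Fin m)} (hT : T.card ≤ d) :
    ∀ S : Finset (Fin m), d < S.card → coeff (chi T) S = 0 := fun S hS => by
  rw [coeff_chi, if_neg]
  rintro rfl
  omega

/-- Constants have degree `≤ d`. -/
theorem lowDeg_const {d : ℕ} (a : ℝ) :
    ∀ S : Finset (Fin m), d < S.card → coeff (fun _ : Fin m → ZMod 2 => a) S = 0 := by
  have h : (fun _ : Fin m → ZMod 2 => a) = a • chi ∅ := by
    funext y; simp
  rw [h]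
  exact lowDeg_smul a (lowDeg_chi (by simp))

/-- Translation multiplies each Walsh coefficient by the character value: `(f(z+·))^(S) = χ_S(z) f̂(S)`. -/
theorem coeff_translate (f : (Fin m → ZMod 2) → ℝ) (z : Fin m → ZMod 2) (S : Finset (Fin m)) :
    coeff (fun u => f (z + u)) S = chi S z * coeff f S := by
  have hsum : ∑ u, f (z + u) * chi S u = chi S z * ∑ y, f y * chi S y := by
    rw [Finset.mul_sum]
    refine Fintype.sum_equiv (Equiv.addLeft z) _ _ fun u => ?_
    simp only [Equiv.coe_addLeft]
    rw [chi_add]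
    have hzz : chi S z * chi S z = 1 := chi_mul_self S z
    calc f (z + u) * chi S u = (chi S z * chi S z) * (f (z + u) * chi S u) := by rw [hzz, one_mul]
      _ = chi S z * (f (z + u) * (chi S z * chi S u)) := by ring
  unfold coeff
  rw [show (∑ y, (fun u => f (z + u)) y * chi S y) = ∑ u, f (z + u) * chi S u from rfl, hsum,
    mul_div_assoc]

/-- Translates of a low-degree function are low-degree. -/
theorem lowDeg_translate {d : ℕ} {f : (Fin m → ZMod 2) → ℝ}
    (hf : ∀ S : Finset (Fin m), d < S.card → coeff f S = 0) (z : Fin m → ZMod 2) :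
    ∀ S : Finset (Fin m), d < S.card → coeff (fun u => f (z + u)) S = 0 := fun S hS => by
  rw [coeff_translate, hf S hS, mul_zero]

/-- A character is the sign of the corresponding parity: `χ_D(z) = sgn (∑_{i ∈ D} z i)`. -/
theorem chi_eq_sgn_sum (D : Finset (Fin m)) (z : Fin m → ZMod 2) : chi D z = sgn (∑ i ∈ D, z i) := by
  classical
  induction D using Finset.induction_on with
  | empty => simp
  | insert a s ha ih =>
    rw [chi, Finset.prod_insert ha, Finset.sum_insert ha, sgn_add, ← chi, ih]

/-- The parity-class indicator `𝟙[∑_{i ∈ D} z i = c₀]`. -/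
def pind (D : Finset (Fin m)) (c₀ : ZMod 2) (z : Fin m → ZMod 2) : ℝ :=
  if ∑ i ∈ D, z i = c₀ then 1 else 0

/-- `𝟙[∑_D z = c₀] = (1 + sgn c₀ · χ_D(z)) / 2`. -/
theorem pind_eq (D : Finset (Fin m)) (c₀ : ZMod 2) (z : Fin m → ZMod 2) :
    pind D c₀ z = (1 + sgn c₀ * chi D z) / 2 := by
  unfold pind
  rw [chi_eq_sgn_sum]
  rcases eq_zero_or_eq_one (∑ i ∈ D, z i) with h | h <;> rcases eq_zero_or_eq_one c₀ with h' | h' <;>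
    simp [h, h']

/-- The parity class is translation-covariant: `𝟙_D(z + u) = (1 + sgn c₀ χ_D(z) χ_D(u)) / 2`. -/
theorem pind_add (D : Finset (Fin m)) (c₀ : ZMod 2) (z u : Fin m → ZMod 2) :
    pind D c₀ (z + u) = (1 + sgn c₀ * chi D z * chi D u) / 2 := by
  rw [pind_eq, chi_add, mul_assoc]

/-- `𝟙_D ≥ 0`. -/
theorem pind_nonneg (D : Finset (Fin m)) (c₀ : ZMod 2) (z : Fin m → ZMod 2) : 0 ≤ pind D c₀ z := by
  unfold pind; split_ifs <;> norm_num

/-- `𝟙_D ∈ {0, 1}`. -/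
theorem pind_eq_zero_or_one (D : Finset (Fin m)) (c₀ : ZMod 2) (z : Fin m → ZMod 2) :
    pind D c₀ z = 0 ∨ pind D c₀ z = 1 := by
  unfold pind; split_ifs <;> simp

variable {V : Type}

/-! ## §2 The density of Grigoriev's functional and the far-character lemma -/

/-- The density `ẽ(u) = 2^{-m} ∑_S e(S) χ_S(u)` of the functional `Ẽ = func A c 1`. -/
def dens (A : V → Finset (Fin m)) (c : V → ZMod 2) (u : Fin m → ZMod 2) : ℝ :=
  ∑ S : Finset (Fin m), e A c 1 S * chi S u / 2 ^ m

/-- `Ẽ f = ∑_u ẽ(u) f(u)`. [folklore] -/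
theorem func_eq_sum_dens (A : V → Finset (Fin m)) (c : V → ZMod 2) (f : (Fin m → ZMod 2) → ℝ) :
    func A c 1 f = ∑ u, dens A c u * f u := by
  rw [func_apply]
  simp only [coeff, dens, Finset.sum_mul, Finset.sum_div]
  rw [Finset.sum_comm]
  refine Finset.sum_congr rfl fun S _ => ?_
  rw [Finset.mul_sum]
  refine Finset.sum_congr rfl fun u _ => ?_
  ring

/-! `D` is FAR (at degree `d`) when `D ∆ S` is never determined (never `∅` nor an equation) for `#S ≤ d`,
spelled `∀ S, S.card ≤ d → ¬ Det A 1 (symmDiff D S)`; for a Tseitin instance satisfying `IsoHyp A 1 d` the boundary of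
any vertex set `x` with `3 ≤ #x ≤ #V − 3` is far (sequel file). -/

/-- **The far character is invisible on low-degree functions**: `Ẽ[χ_D · f] = 0` if `D` is far and `deg f ≤ d`. -/
theorem func_chi_mul_eq_zero {A : V → Finset (Fin m)} (c : V → ZMod 2) {d : ℕ} {D : Finset (Fin m)}
    (hD : ∀ S : Finset (Fin m), S.card ≤ d → ¬ Det A 1 (symmDiff D S)) {f : (Fin m → ZMod 2) → ℝ}
    (hf : ∀ S : Finset (Fin m), d < S.card → coeff f S = 0) :
    func A c 1 (fun u => chi D u * f u) = 0 := by
  have hexp : (fun u => chi D u * f u) = ∑ S, coeff f S • chi (symmDiff D S) := by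
    conv_lhs => rw [eq_sum_coeff_smul_chi f]
    funext u
    simp only [Finset.sum_apply, Pi.smul_apply, smul_eq_mul, Finset.mul_sum]
    refine Finset.sum_congr rfl fun S _ => ?_
    rw [← chi_mul_chi]; ring
  rw [hexp, map_sum]
  refine Finset.sum_eq_zero fun S _ => ?_
  rw [map_smul, func_chi, smul_eq_mul]
  by_cases hS : d < S.card
  · rw [hf S hS, zero_mul]
  · rw [e_eq_zero (hD S (not_lt.mp hS)), mul_zero]

/-! ## §3 The kernel `Λ` and its row and column sums -/

/-- The certificate kernel `Λ(z,y) = (𝟙_D(z) + 𝟙_D(y) − ½) · ẽ(z + y)`. -/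
def Lam (A : V → Finset (Fin m)) (c : V → ZMod 2) (D : Finset (Fin m)) (c₀ : ZMod 2)
    (z y : Fin m → ZMod 2) : ℝ :=
  (pind D c₀ z + pind D c₀ y - 1 / 2) * dens A c (z + y)

/-- Characteristic two on the cube: `z + (z + u) = u`. -/
theorem add_add_cancel_left' (z u : Fin m → ZMod 2) : z + (z + u) = u := by
  funext i
  simp only [Pi.add_apply]
  rw [← add_assoc, CharTwo.add_self_eq_zero, zero_add]

/-- **Row sums.** `∑_y Λ(z,y) G(y) = (𝟙_D(z) − ½) Ẽ[G(z+·)] + Ẽ[𝟙_D(z+·) G(z+·)]`. -/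
theorem row_sum (A : V → Finset (Fin m)) (c : V → ZMod 2) (D : Finset (Fin m)) (c₀ : ZMod 2)
    (G : (Fin m → ZMod 2) → ℝ) (z : Fin m → ZMod 2) :
    ∑ y, Lam A c D c₀ z y * G y =
      (pind D c₀ z - 1 / 2) * func A c 1 (fun u => G (z + u)) +
        func A c 1 (fun u => pind D c₀ (z + u) * G (z + u)) := by
  rw [func_eq_sum_dens, func_eq_sum_dens, Finset.mul_sum, ← Finset.sum_add_distrib]
  refine (Fintype.sum_equiv (Equiv.addLeft z) _ _ fun u => ?_).symm
  simp only [Equiv.coe_addLeft, Lam]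
  rw [add_add_cancel_left']
  ring

/-- `Λ` is symmetric. -/
theorem lam_symm (A : V → Finset (Fin m)) (c : V → ZMod 2) (D : Finset (Fin m)) (c₀ : ZMod 2)
    (z y : Fin m → ZMod 2) : Lam A c D c₀ z y = Lam A c D c₀ y z := by
  unfold Lam
  rw [add_comm z y]
  ring

/-- **Column sums.** `∑_z Λ(z,y) G(z) = (𝟙_D(y) − ½) Ẽ[G(y+·)] + Ẽ[𝟙_D(y+·) G(y+·)]`. -/
theorem col_sum (A : V → Finset (Fin m)) (c : V → ZMod 2) (D : Finset (Fin m)) (c₀ : ZMod 2)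
    (G : (Fin m → ZMod 2) → ℝ) (y : Fin m → ZMod 2) :
    ∑ z, Lam A c D c₀ z y * G z =
      (pind D c₀ y - 1 / 2) * func A c 1 (fun u => G (y + u)) +
        func A c 1 (fun u => pind D c₀ (y + u) * G (y + u)) := by
  rw [← row_sum]
  exact Finset.sum_congr rfl fun z _ => by rw [lam_symm]

/-- **Low-degree row sums.** If `D` is far and `G(z+·)` has degree `≤ d` then `∑_y Λ(z,y) G(y) = 𝟙_D(z) Ẽ[G(z+·)]`. -/
theorem row_sum_lowDeg {A : V → Finset (Fin m)} (c : V → ZMod 2) {d : ℕ} {D : Finset (Fin m)}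
    (hD : ∀ S : Finset (Fin m), S.card ≤ d → ¬ Det A 1 (symmDiff D S)) (c₀ : ZMod 2)
    {G : (Fin m → ZMod 2) → ℝ} {z : Fin m → ZMod 2}
    (hG : ∀ S : Finset (Fin m), d < S.card → coeff (fun u => G (z + u)) S = 0) :
    ∑ y, Lam A c D c₀ z y * G y = pind D c₀ z * func A c 1 (fun u => G (z + u)) := by
  rw [row_sum]
  have hsplit : (fun u => pind D c₀ (z + u) * G (z + u)) =
      (1 / 2 : ℝ) • (fun u => G (z + u)) + (sgn c₀ * chi D z / 2) • fun u => chi D u * G (z + u) := by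
    funext u
    simp only [Pi.add_apply, Pi.smul_apply, smul_eq_mul]
    rw [pind_add]
    ring
  rw [hsplit, map_add, map_smul, map_smul, func_chi_mul_eq_zero c hD hG, smul_eq_mul, smul_eq_mul,
    mul_zero, add_zero]
  ring

/-- **Low-degree column sums.** Dually, `∑_z Λ(z,y) G(z) = 𝟙_D(y) Ẽ[G(y+·)]` when `G(y+·)` has degree `≤ d`. -/
theorem col_sum_lowDeg {A : V → Finset (Fin m)} (c : V → ZMod 2) {d : ℕ} {D : Finset (Fin m)}
    (hD : ∀ S : Finset (Fin m), S.card ≤ d → ¬ Det A 1 (symmDiff D S)) (c₀ : ZMod 2)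
    {G : (Fin m → ZMod 2) → ℝ} {y : Fin m → ZMod 2}
    (hG : ∀ S : Finset (Fin m), d < S.card → coeff (fun u => G (y + u)) S = 0) :
    ∑ z, Lam A c D c₀ z y * G z = pind D c₀ y * func A c 1 (fun u => G (y + u)) := by
  rw [← row_sum_lowDeg c hD c₀ hG]
  exact Finset.sum_congr rfl fun z _ => by rw [lam_symm]

/-! ## §4 The violation count and the contradiction -/

variable [Fintype V] [DecidableEq V]

/-- The number of equations of the instance `(A, c)` violated by `u` (as a real number). -/
def violCount (A : V → Finset (Fin m)) (c : V → ZMod 2) (u : Fin m → ZMod 2) : ℝ :=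
  ∑ v, if chi (A v) u = sgn (c v) then (0 : ℝ) else 1

omit [DecidableEq V] in
/-- The violation count has degree `≤ d` as soon as every equation has at most `d` variables. -/
theorem lowDeg_violCount {A : V → Finset (Fin m)} (c : V → ZMod 2) {d : ℕ} (hA : ∀ v, (A v).card ≤ d) :
    (∀ S : Finset (Fin m), d < S.card → coeff (violCount A c) S = 0) := by
  have h : violCount A c = ∑ v, ((1 / 2 : ℝ) • (fun _ => (1 : ℝ)) + (-(sgn (c v) / 2)) • chi (A v)) := by
    funext u
    simp only [violCount, Finset.sum_apply, Pi.add_apply, Pi.smul_apply, smul_eq_mul]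
    refine Finset.sum_congr rfl fun v _ => ?_
    rw [violInd_eq]
    ring
  rw [h]
  exact lowDeg_sum _ fun v _ => lowDeg_add (lowDeg_smul _ (lowDeg_const 1)) (lowDeg_smul _ (lowDeg_chi (hA v)))

/-- Perfect completeness for the count: `Ẽ[violCount] = 0`. -/
theorem IsoHyp.func_violCount {A : V → Finset (Fin m)} {d : ℕ} (h : IsoHyp A 1 d) (c : V → ZMod 2) :
    func A c 1 (violCount A c) = 0 := by
  have hsum : violCount A c = ∑ v, fun u => if chi (A v) u = sgn (c v) then (0 : ℝ) else 1 := by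
    funext u; simp [violCount]
  rw [hsum, map_sum]
  exact Finset.sum_eq_zero fun v _ => h.func_violInd c v

/-- **The core certificate (mixed junta × anchor).** Let `(A, c)` satisfy `IsoHyp A 1 d` with equations of at most `d`
variables, `D` far, `c₀ : 𝔽₂`. Suppose `violCount(z + y) = ∑_l T_l(z, y) + α(z) β(y)` for all `z, y`, where each
`T_l ≥ 0` is a `d`-junta of `z` for every `y` OR a `d`-junta of `y` for every `z`, `α > 0`, `β` has Fourier degree
`≤ d`, and `β̌(z) := Ẽ[β(z + ·)]` is `≥ 0` on the parity class `{∑_D z = c₀}` and `> 0` somewhere on it. Then `False`: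
pairing the identity with `Λ` gives `0 = (≥ 0) + ∑_z α(z) 𝟙_D(z) β̌(z) > 0`. -/
theorem mixed_anchor_core_contra_of {A : V → Finset (Fin m)} {c : V → ZMod 2} {d : ℕ} (h : IsoHyp A 1 d)
    (hA : ∀ v, (A v).card ≤ d) {D : Finset (Fin m)}
    (hD : ∀ S : Finset (Fin m), S.card ≤ d → ¬ Det A 1 (symmDiff D S)) (c₀ : ZMod 2)
    {L : Type} [Fintype L] (S : L → Finset (Fin m)) (hS : ∀ l, (S l).card ≤ d)
    (T : L → (Fin m → ZMod 2) → (Fin m → ZMod 2) → ℝ) (hT0 : ∀ l z y, 0 ≤ T l z y)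
    (hT : ∀ l, (∀ (y : Fin m → ZMod 2) (z z' : Fin m → ZMod 2),
                  (∀ i ∈ S l, z i = z' i) → T l z y = T l z' y) ∨
               (∀ (z : Fin m → ZMod 2) (y y' : Fin m → ZMod 2),
                  (∀ i ∈ S l, y i = y' i) → T l z y = T l z y'))
    (α β : (Fin m → ZMod 2) → ℝ) (hα : ∀ z, 0 < α z)
    (hβ : ∀ S : Finset (Fin m), d < S.card → coeff β S = 0)
    (hsign : ∀ z, (∑ i ∈ D, z i) = c₀ → 0 ≤ func A c 1 (fun u => β (z + u)))
    (hstrict : ∃ z, (∑ i ∈ D, z i) = c₀ ∧ 0 < func A c 1 (fun u => β (z + u)))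
    (hid : ∀ z y : Fin m → ZMod 2, violCount A c (z + y) = ∑ l, T l z y + α z * β y) : False := by
  classical
  -- pair the identity with `Λ`: `∑_z ∑_y Λ(z,y) · (identity at (z,y))`
  have hpair : ∑ z, ∑ y, Lam A c D c₀ z y * violCount A c (z + y) =
      ∑ l, ∑ z, ∑ y, Lam A c D c₀ z y * T l z y + ∑ z, ∑ y, Lam A c D c₀ z y * (α z * β y) := by
    have h1 : ∀ z y, Lam A c D c₀ z y * violCount A c (z + y) =
        ∑ l, Lam A c D c₀ z y * T l z y + Lam A c D c₀ z y * (α z * β y) := fun z y => by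
      rw [hid z y, mul_add, Finset.mul_sum]
    simp_rw [h1, Finset.sum_add_distrib]
    congr 1
    calc ∑ z, ∑ y, ∑ l, Lam A c D c₀ z y * T l z y
        = ∑ z, ∑ l, ∑ y, Lam A c D c₀ z y * T l z y :=
          Finset.sum_congr rfl fun z _ => Finset.sum_comm
      _ = ∑ l, ∑ z, ∑ y, Lam A c D c₀ z y * T l z y := Finset.sum_comm
  -- left side: zero (the count has low degree, `Ẽ[count] = 0`)
  have hleft : ∑ z, ∑ y, Lam A c D c₀ z y * violCount A c (z + y) = 0 := by
    refine Finset.sum_eq_zero fun z _ => ?_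
    have hlow : (∀ S : Finset (Fin m), d < S.card → coeff (fun u => violCount A c (z + (z + u))) S = 0) := by
      have : (fun u => violCount A c (z + (z + u))) = violCount A c := by
        funext u; rw [add_add_cancel_left']
      rw [this]; exact lowDeg_violCount c hA
    rw [row_sum_lowDeg c hD c₀ (G := fun y => violCount A c (z + y)) hlow]
    have : (fun u => violCount A c (z + (z + u))) = violCount A c := by
      funext u; rw [add_add_cancel_left']
    rw [this, h.func_violCount c, mul_zero]
  -- junta terms: non-negative
  have hterms : ∀ l, 0 ≤ ∑ z, ∑ y, Lam A c D c₀ z y * T l z y := by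
    intro l
    rcases hT l with hrow | hcol
    · -- `d`-junta of `z` for every `y`: use column sums
      rw [Finset.sum_comm]
      refine Finset.sum_nonneg fun y _ => ?_
      have hj : ∀ x x' : Fin m → ZMod 2, (∀ i ∈ S l, x i = x' i) →
          T l (y + x) y = T l (y + x') y := fun x x' hxx' =>
        hrow y _ _ fun i hi => by simp only [Pi.add_apply, hxx' i hi]
      rw [col_sum_lowDeg c hD c₀ (G := fun z => T l z y) (lowDeg_of_junta (hS l) hj)]
      exact mul_nonneg (pind_nonneg _ _ _) (h.func_nonneg_of_junta c (hS l) hj fun x => hT0 l _ _)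
    · -- `d`-junta of `y` for every `z`: use row sums
      refine Finset.sum_nonneg fun z _ => ?_
      have hj : ∀ x x' : Fin m → ZMod 2, (∀ i ∈ S l, x i = x' i) →
          T l z (z + x) = T l z (z + x') := fun x x' hxx' =>
        hcol z _ _ fun i hi => by simp only [Pi.add_apply, hxx' i hi]
      rw [row_sum_lowDeg c hD c₀ (G := fun y => T l z y) (lowDeg_of_junta (hS l) hj)]
      exact mul_nonneg (pind_nonneg _ _ _) (h.func_nonneg_of_junta c (hS l) hj fun x => hT0 l _ _)
  -- anchor term: `∑_z α(z) 𝟙_D(z) β̌(z) > 0`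
  have hanchor : ∑ z, ∑ y, Lam A c D c₀ z y * (α z * β y) =
      ∑ z, α z * (pind D c₀ z * func A c 1 (fun u => β (z + u))) := by
    refine Finset.sum_congr rfl fun z _ => ?_
    have h1 : ∑ y, Lam A c D c₀ z y * (α z * β y) = α z * ∑ y, Lam A c D c₀ z y * β y := by
      rw [Finset.mul_sum]
      exact Finset.sum_congr rfl fun y _ => by ring
    rw [h1, row_sum_lowDeg c hD c₀ (G := β) (lowDeg_translate hβ z)]
  have hpos : 0 < ∑ z, α z * (pind D c₀ z * func A c 1 (fun u => β (z + u))) := by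
    obtain ⟨z₀, hz₀, hz₀'⟩ := hstrict
    have hnn : ∀ z ∈ (univ : Finset (Fin m → ZMod 2)),
        0 ≤ α z * (pind D c₀ z * func A c 1 (fun u => β (z + u))) := by
      intro z _
      rcases pind_eq_zero_or_one D c₀ z with h0 | h1
      · rw [h0, zero_mul, mul_zero]
      · have hz : (∑ i ∈ D, z i) = c₀ := by
          by_contra hne
          simp [pind, hne] at h1
        rw [h1, one_mul]
        exact mul_nonneg (hα z).le (hsign z hz)
    refine lt_of_lt_of_le ?_ (Finset.single_le_sum hnn (mem_univ z₀))
    have h1 : pind D c₀ z₀ = 1 := by simp [pind, hz₀]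
    rw [h1, one_mul]
    exact mul_pos (hα z₀) hz₀'
  -- assemble
  have hsum : 0 ≤ ∑ l, ∑ z, ∑ y, Lam A c D c₀ z y * T l z y := Finset.sum_nonneg fun l _ => hterms l
  rw [hleft, hanchor] at hpair
  linarith


/-- **The core certificate (mixed junta × anchor)** — registered sub-goal `mixed_anchor_core_contra` of
stmt-PneNP-10680, verbatim signature (see `mixed_anchor_core_contra_of`). -/
theorem mixed_anchor_core_contra :
    ∀ {m : ℕ} {V : Type} [Fintype V] [DecidableEq V] {A : V → Finset (Fin m)} {c : V → ZMod 2} {d : ℕ},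
    IsoHyp A 1 d → (∀ v, (A v).card ≤ d) → ∀ {D : Finset (Fin m)}, (∀ S : Finset (Fin m), S.card ≤ d →
    ¬ Det A 1 (symmDiff D S)) → ∀ (c₀ : ZMod 2) {L : Type} [Fintype L] (S : L → Finset (Fin m)), (∀ l, (S
    l).card ≤ d) → ∀ (T : L → (Fin m → ZMod 2) → (Fin m → ZMod 2) → ℝ), (∀ l z y, 0 ≤ T l z y) → (∀ l, (∀
    (y : Fin m → ZMod 2) (z z' : Fin m → ZMod 2), (∀ i ∈ S l, z i = z' i) → T l z y = T l z' y) ∨ (∀ (z : Fin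
    m → ZMod 2) (y y' : Fin m → ZMod 2), (∀ i ∈ S l, y i = y' i) → T l z y = T l z y')) → ∀ (α β : (Fin m →
    ZMod 2) → ℝ), (∀ z, 0 < α z) → (∀ S : Finset (Fin m), d < S.card → coeff β S = 0) → (∀ z : Fin m → ZMod
    2, (∑ i ∈ D, z i) = c₀ → 0 ≤ func A c 1 (fun u => β (z + u))) → (∃ z : Fin m → ZMod 2, (∑ i ∈ D, z i) =
    c₀ ∧ 0 < func A c 1 (fun u => β (z + u))) → (∀ z y : Fin m → ZMod 2, violCount A c (z + y) = ∑ l, T l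
    z y + α z * β y) → False :=
  fun h hA _ hD c₀ _ _ S hS T hT0 hT α β hα hβ hsign hstrict hid =>
    mixed_anchor_core_contra_of h hA hD c₀ S hS T hT0 hT α β hα hβ hsign hstrict hid

end

end Summit.PneNP.PneNP.Theorems.XorDoor.PC
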